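import Summits.BirchSwinnertonDyer.BirchSwinnertonDyer.Theorems.ByReductionTypeAtTwoSupersingularUnitAnchorKitMTNegDisc
import Summits.BirchSwinnertonDyer.BirchSwinnertonDyer.Theorems.ByReductionTypeAtTwoSupersingularThetaHabitatMTTP2Items
import HarnessLib

/-!
# Crux `SupersingularRankZeroAtTwo` (item stmt-BirchSwinnertonDyer-19097, route `ByReductionTypeAtTwo`, rung K4): the UNIT-ANCHOR road,
# `Λ`-FORM, MAZUR–TATE KEYED, with the `E`-SIDE research inputs RE-KEYED TO ROUTE TP2's ITEMS K3/K4 BY NAME and the `μ`-transport at the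
# pair in the kernel (`Δ_E < 0`) (seat `bsd-2adic-ss-1x` GEN 6; companion of GEN 4's `…UnitAnchorTransportMC` p560616, GEN 5's
# `…MazurTateReading` p576558 / `…UnitAnchorKitMT` p577225, and this GEN's `…UnitAnchorKitMTNegDisc` p588504)

HONEST FRAMING (cells `bsd-2adic` / `bsd-wall`; HUMAN RULINGS D-0036/D-0054/D-0074): THEOREMS ONLY — no definition, no named fact, no instance,
no `sorry`; two hypotheses are the OPEN items K3 `SignedKatoDivisibilityUpToAtTwo` (20308) and K4 `SignedControlAtTwo` (20309) of route
`ThetaPartnerAtTwo`, taken BY NAME at the curve `E` (they apply: `E` non-CM, analytic rank `0`, good ss at `2`, `a₂ = 0`); they are NOT proved here;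
closes no item; BSD is NOT proved by any of this. PARTITION (D-0054): X5@2 good-ss `a₂ = 0` UNIT-ANCHOR sub-row (the 12 classes with `Δ_E < 0`)
× `p = 2` — types-the-object-of; bears_on K4 19097 · TP2 20308 · 20309.

WHAT. GEN 4's `SSUnitAnchor.kobayashiMainConjecture_two_of_unitAnchor` took AT `E` the (2′) signed Euler characteristic `hEC` (for the
`Λ`-torsion of `X⁺_E` and Kim's term) and the rational Coleman–Kato package (4)ʳᵃᵗ `hCK` + Kato's PUB facts (for Kato UP TO `2^m`). Here:
torsion of `X⁺_E` comes from the anchor through the CM-free kernel transport (`SignedTransportAtTwo.TwoCongruence.isTorsion_and_mu_eq_zero_of_twoCongruence_negDisc`,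
`Δ_E < 0`), Kato UP TO `2^m` is K3 BY NAME, and Kim's term + finite generation are K4 BY NAME. AT the anchor `A` (non-CM, unit zone) the (2′) binder
`hECA` stays (it is what makes `X⁺_A` torsion with `char = Λ`: `torsion_and_charIdeal_eq_top_and_mu_eq_zero_of_unitZone`, GEN 4); AT the pair the
`λ`-transport `hlamT` (numeral `ℓ*`) stays (TP2's 21415 is stated for a CM partner). Displayed: PUB {`hmod`, `hGZK`, `h2`}; ITEMS {`hK3`, `hK4`};
research {`hECA`, `hlamT`}; CERT {`hTam`, `hSha`, `L`-values, layer certificate `hMT`}; KERNEL {transport, `Δ_E < 0`, `E[2] ≅ A[2]`}.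
* `SSUnitAnchor.kobayashiMainConjecture_and_bsdp_two_of_unitAnchor_of_thetaPartnerItems_negDisc` — the pair door;
* `SSUnitAnchor.bsdp_two_baseChange_int_of_unitAnchor_of_thetaPartnerItems_negDisc` — kit twin on integer models (Tschirnhaus pair).

References: [BDKim2009] Cor. 2.13, Prop. 2.6; [GreenbergVatsal2000] Thm. (1.4); [Kobayashi2003] Thm. 1.2, 4.1; [Kato2004Asterisque] Thm. 12.4–12.5 (3);
[BDKim2013] Cor. 3.15; [Pollack2003] Prop. 6.18; [PollackWeston2011MT] §3.1; [AbbesUllmo1996] Thm. A; [Washington1997] §13.2; [Miller2011LMS] Def. 1.1.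
-/

set_option autoImplicit false
-- the Theorems namespace of this sub repeats the summit name by design (D-0017 nested layout)
set_option linter.dupNamespace false

noncomputable section

open scoped Classical MatrixGroups ModularForm Polynomial

open CongruenceSubgroup Polynomial WeierstrassCurve Literature.NumberTheory.EllipticCurves
  Literature.NumberTheory.EllipticCurves.ModularForms Literature.NumberTheory.EllipticCurves.Sprung2017
  Literature.NumberTheory.EllipticCurves.Rank1Residual Literature.NumberTheory.EllipticCurves.Rank1Residual.Typed
  Literature.NumberTheory.EllipticCurves.Kobayashi2003 Literature.NumberTheory.EllipticCurves.IwasawaDual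
  Literature.NumberTheory.IwasawaTheory
  ZpExtension Summit.BirchSwinnertonDyer.Rank1Residual Summit.BirchSwinnertonDyer.Rank1Residual.Supersingular
  Summit.BirchSwinnertonDyer.Rank1Residual.X5.O1 Summit.BirchSwinnertonDyer.Rank1Residual.X1.MuLambda
  Summit.BirchSwinnertonDyer.BirchSwinnertonDyer.Theses.ThetaPartnerAtTwo

namespace Summit.BirchSwinnertonDyer.BirchSwinnertonDyer.Theorems
namespace SSUnitAnchor

/-! ## §1 The pair door -/

/-- **UNIT-ANCHOR ROAD, `Λ`-FORM, MAZUR–TATE KEYED — K3/K4 BY NAME AT `E`, `μ`-TRANSPORT IN THE KERNEL.** `W` non-CM of analytic rank `0`,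
good supersingular at `2` with `a₂ = 0`, `Δ_W < 0`; `A` of analytic rank `0`, good ss at `2` with `a₂ = 0`, in the double unit zone (`2 ∤ ∏c_ℓ(A)`,
`2 ∤ #Ш(A)`); a Galois-equivariant `e : W[2] ≃ A[2]`. From PUB {`hmod`, `hGZK`, `h2`}, route TP2's OPEN items BY NAME at `W` {`hK3 :
SignedKatoDivisibilityUpToAtTwo` (20308), `hK4 : SignedControlAtTwo` (20309)}, (2′) at the anchor `hECA` (research), the `λ`-transport `hlamT`
(numeral `ℓ`, research), the layer certificate `hMT` (CERT) and the kernel transport: `KobayashiMainConjecture W 2 1 ∧ BSDp W 2`. Chain: anchor ⇒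
`X⁺_A` torsion, `char = Λ`, `μ = λ = 0` (GEN 4 `torsion_and_charIdeal_eq_top_and_mu_eq_zero_of_unitZone`); kernel transport ⇒ `X⁺_W` torsion,
`μ = 0`; `hlamT` ⇒ `λ(X⁺_W) = ℓ`; K3 + layer certificate ⇒ `h = 2^m u` ⇒ `char X⁺_W = (ϖ L♭_W)`; K4 ⇒ BSD₂ by the `a₂ = 0` door. The two items are
hypotheses; closes nothing; BSD is not proved by any of this. [cite: BDKim2009, Cor. 2.13 and Prop. 2.6] [cite: Kobayashi2003, Thm. 1.2 and Thm. 4.1]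
[cite: Kato2004Asterisque, Thm. 12.4–12.5 (3)] [cite: BDKim2013, Cor. 3.15] [cite: Pollack2003, Prop. 6.18] [cite: AbbesUllmo1996, Thm. A]
[cite: Washington1997, §13.2] [cite: Miller2011LMS, Def. 1.1] -/
theorem kobayashiMainConjecture_and_bsdp_two_of_unitAnchor_of_thetaPartnerItems_negDisc
    (W : WeierstrassCurve ℚ) [W.IsElliptic] [W.IsGloballyMinimal] (A : WeierstrassCurve ℚ) [A.IsElliptic] [A.IsGloballyMinimal]
    (hmod : nonempty_modularParametrizationData) (hGZK : rank_eq_analyticRank_of_analyticRank_le_one)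
    (h2 : realPeriodRat_eq_unit_mul_plusPeriod_two)
    (hK3 : Summit.BirchSwinnertonDyer.BirchSwinnertonDyer.Theses.ThetaPartnerAtTwo.SignedKatoDivisibilityUpToAtTwo)
    (hK4 : Summit.BirchSwinnertonDyer.BirchSwinnertonDyer.Theses.ThetaPartnerAtTwo.SignedControlAtTwo)
    (hcm : ¬ W.HasCM) (hr : W.analyticRank = 0) (hss : GoodSS W 2) (ha : W.frobeniusTrace 2 = 0) (hΔ : W.Δ < 0)
    (hAr : A.analyticRank = 0) (hAss : GoodSS A 2) (hAa : A.frobeniusTrace 2 = 0)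
    (hTam : ¬ 2 ∣ A.tamagawaProduct) (hSha : ¬ 2 ∣ A.shaOrder)
    (e : WeierstrassCurve.geomTorsion W (2 : ℤ) ≃+ WeierstrassCurve.geomTorsion A (2 : ℤ))
    (he : ∀ (σ : Field.absoluteGaloisGroup ℚ) (P : WeierstrassCurve.geomTorsion W (2 : ℤ)), e (σ • P) = σ • e P)
    (hECA : ∀ (κ : ZpExtension ℚ 2) (γ : Field.absoluteGaloisGroup ℚ),
          κ.IsCyclotomic → κ.IsTopGenerator γ → Finite (A.selmerGroupPInfty 2) →
          Finite (endInvariants (conjSignedSelmerInfty A κ 1 γ - 1)) ∧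
            ∃ u : ℤ_[2]ˣ, (Nat.card (endInvariants (conjSignedSelmerInfty A κ 1 γ - 1)) : ℚ_[2]) =
              ((u : ℤ_[2]) : ℚ_[2]) * ((2 : ℕ) : ℚ_[2]) ^ (padicValNat 2 A.tamagawaProduct) *
                (Nat.card (A.selmerGroupPInfty 2) : ℚ_[2]) *
                  (Nat.card (EndCoinvariants (conjSignedSelmerInfty A κ 1 γ - 1)) : ℚ_[2]))
    (ℓ : ℕ)
    (hlamT : GoodSS W 2 → W.frobeniusTrace 2 = 0 → GoodSS A 2 → A.frobeniusTrace 2 = 0 →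
      (∃ e : WeierstrassCurve.geomTorsion W (2 : ℤ) ≃+ WeierstrassCurve.geomTorsion A (2 : ℤ),
        ∀ (σ : Field.absoluteGaloisGroup ℚ) (P : WeierstrassCurve.geomTorsion W (2 : ℤ)), e (σ • P) = σ • e P) →
      ∀ (κ : ZpExtension ℚ 2) (γ : Field.absoluteGaloisGroup ℚ), κ.IsCyclotomic → κ.IsTopGenerator γ →
      ∀ (D : SignedSelmerDualData W κ γ 1) (D' : SignedSelmerDualData A κ γ 1)
        [Module.Finite (IwasawaAlgebra 2) D.X] [Module.Finite (IwasawaAlgebra 2) D'.X],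
        Module.IsTorsion (IwasawaAlgebra 2) D.X → Module.IsTorsion (IwasawaAlgebra 2) D'.X →
        D.mu = 0 → D'.mu = 0 → lambdaInvariant 2 D.X = lambdaInvariant 2 D'.X + ℓ)
    {n : ℕ} (hn : Even n)
    (hMT : ∀ [NeZero (W.conductorNorm ℤ)] (f : CuspForm (Gamma0 (W.conductorNorm ℤ)) 2), IsNewformOf W f →
      ((mazurTateElement f 2 n).map (algebraMap ℚ (PadicAlgCl 2))).supNorm = 1 ∧
        layerLambda ((mazurTateElement f 2 n).map (algebraMap ℚ (PadicAlgCl 2))) = (2 ^ n - 1) / 3 + ℓ) :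
    KobayashiMainConjecture W 2 1 ∧ BSDp W 2 := by
  have hLrat : hasEntireLFunction_rat := WeierstrassCurve.hasEntireLFunction_rat_of_exists_isNewformOf
    (exists_isNewformOf_of_nonempty_modularParametrizationData hmod)
  have hL : W.entireLFunction 1 ≠ 0 := (W.analyticRank_eq_zero_iff_holds (hLrat W)).mp hr
  have hMC : KobayashiMainConjecture W 2 1 := by
    intro κ γ hκ hγ hγ' _ f hf ϖ hϖ Lplus Lminus hPP D
    haveI : Module.Finite (IwasawaAlgebra 2) D.X := Kobayashi2003.SignedSelmerDualData.moduleFinite hγ D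
    -- the anchor's datum: torsion, `char = Λ`, `μ = 0`, hence `λ = 0`
    obtain ⟨DA⟩ := nonempty_signedSelmerDualData A κ (1 : ℤˣ) hγ
    obtain ⟨hfinA, hXA, hcharA, hμA⟩ :=
      torsion_and_charIdeal_eq_top_and_mu_eq_zero_of_unitZone A hmod hGZK hAr hECA hTam hSha κ γ hκ hγ DA
    haveI := hfinA
    have hcharA' : DA.charIdeal = Ideal.span {(1 : IwasawaAlgebra 2)} := by rw [hcharA, Ideal.span_singleton_one]
    have hlamA : lambdaInvariant 2 DA.X = 0 := by
      rw [← Summit.BirchSwinnertonDyer.Rank1Residual.X1.ParitySqueeze.lam_generator_eq_lambdaInvariant DA.X hXA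
        one_ne_zero hcharA']
      exact ((isUnit_iff_mu_eq_zero_and_lam_eq_zero (1 : IwasawaAlgebra 2)).mp isUnit_one).2.2
    -- KERNEL transport of torsion and `μ = 0` from the anchor (CM-free, `Δ_W < 0`)
    obtain ⟨hX, hμD⟩ := SignedTransportAtTwo.TwoCongruence.isTorsion_and_mu_eq_zero_of_twoCongruence_negDisc
      W hss ha hΔ A hAss hAa e he κ γ hκ D DA hXA hμA
    refine ⟨hX, ?_⟩
    -- `λ(X⁺_W) = ℓ`
    have hlamD : lambdaInvariant 2 D.X = ℓ := by
      rw [hlamT hss ha hAss hAa ⟨e, he⟩ κ γ hκ hγ D DA hX hXA hμD hμA, hlamA, zero_add]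
    -- K3 BY NAME at `W`, and the layer certificate of `W` read on `g·h`
    obtain ⟨g, h, m, hchar, hgh⟩ := hK3 W hcm hr hss ha κ γ hκ hγ hγ' f hf ϖ hϖ Lplus Lminus hPP D
    obtain ⟨hμgh, hlgh⟩ :=
      SSMazurTate.reading_two_of_layerCertificate W h2 hss hn ℓ hMT κ γ hκ hγ hγ' f hf ϖ hϖ Lplus Lminus hPP (g * h) m hgh
    set ι := iwasawaToPowerSeries 2 with hι
    have hL0 : PowerSeries.C (ϖ : ℚ_[2]) * ι (kobayashiL (1 : ℤˣ) Lplus Lminus) ≠ 0 :=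
      SignedTransportAtTwo.C_mul_iota_ne_zero hf hϖ hPP
    have hgh0 : g * h ≠ 0 := by
      intro h0
      apply SignedTransportAtTwo.C_pow_mul_ne_zero m hL0
      rw [← hgh, h0, map_zero]
    have hg0 : g ≠ 0 := left_ne_zero_of_mul hgh0
    have hh0 : h ≠ 0 := right_ne_zero_of_mul hgh0
    have hμg : mu g = 0 := by
      rw [Summit.BirchSwinnertonDyer.Rank1Residual.X1.MuPart.mu_generator_eq_muInvariant D.X hX hg0 hchar]
      exact hμD
    have hlamg : lam g = ℓ := by
      rw [Summit.BirchSwinnertonDyer.Rank1Residual.X1.ParitySqueeze.lam_generator_eq_lambdaInvariant D.X hX hg0 hchar]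
      exact hlamD
    rw [mu_mul hg0 hh0, hμg] at hμgh
    rw [lam_mul hg0 hh0, hlamg] at hlgh
    have hμh : mu h = m := by omega
    have hlamh : lam h = 0 := by omega
    obtain ⟨u, hu⟩ := SignedTransportAtTwo.exists_unit_of_mu_of_lam hh0 hμh hlamh
    have h2m : (PowerSeries.C ((2 : ℚ_[2]) ^ m) : PowerSeries ℚ_[2]) ≠ 0 :=
      (map_ne_zero_iff _ PowerSeries.C_injective).mpr (pow_ne_zero m two_ne_zero)
    have hιh : ι h = PowerSeries.C ((2 : ℚ_[2]) ^ m) * ι (u : IwasawaAlgebra 2) := by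
      rw [hu, map_mul, hι, PowerSeries.map_C, map_pow, map_ofNat]
    refine ⟨g * u, ?_, ?_⟩
    · rw [hchar]; exact (Ideal.span_singleton_mul_right_unit u.isUnit g).symm
    · have key : PowerSeries.C ((2 : ℚ_[2]) ^ m) * ι (g * u) =
          PowerSeries.C ((2 : ℚ_[2]) ^ m) * (PowerSeries.C (ϖ : ℚ_[2]) * ι (kobayashiL (1 : ℤˣ) Lplus Lminus)) := by
        calc PowerSeries.C ((2 : ℚ_[2]) ^ m) * ι (g * ↑u)
            = ι g * (PowerSeries.C ((2 : ℚ_[2]) ^ m) * ι ↑u) := by rw [map_mul]; ring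
          _ = ι (g * h) := by rw [map_mul, hιh]
          _ = PowerSeries.C ((2 : ℚ_[2]) ^ m * (ϖ : ℚ_[2])) * ι (kobayashiL (1 : ℤˣ) Lplus Lminus) := hgh
          _ = PowerSeries.C ((2 : ℚ_[2]) ^ m) * (PowerSeries.C (ϖ : ℚ_[2]) * ι (kobayashiL (1 : ℤˣ) Lplus Lminus)) := by
            rw [map_mul, mul_assoc]
      exact mul_left_cancel₀ h2m key
  obtain ⟨h12, hKim⟩ := hK4 W hcm hr hss ha
  exact ⟨hMC, bsdp_two_of_kobayashiMainConjecture_two_of_frobeniusTrace_eq_zero W hmod hGZK hss.1 ha hL h12 hKim hMC⟩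

/-! ## §2 The kit twin on integer models -/

section Door

variable (ME MA : WeierstrassCurve ℤ)
  [(ME.baseChange ℚ).IsElliptic] [(ME.baseChange ℚ).IsGloballyMinimal]
  [(MA.baseChange ℚ).IsElliptic] [(MA.baseChange ℚ).IsGloballyMinimal]

/-- **KIT DOOR, unit-anchor road, K3/K4 BY NAME at `E`, `μ`-transport in the kernel (`Δ(M_E) < 0`).** Integer models `M_E` (non-CM,
`L(E,1) ≠ 0`, good ss at `2`, `a₂ = 0`, `Δ < 0`), `M_A` (the anchor: `L(A,1) ≠ 0`, good ss at `2`, `a₂ = 0`, double unit zone) and a Tschirnhaus pair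
`(q, r)` certifying `E[2] ≅ A[2]`; PUB (`hmod`, `hGZK`, `h2`) + ITEMS BY NAME (`hK3` 20308, `hK4` 20309) + research (`hECA`, `hlamT` with numeral `ℓ`) +
CERT (`hTam`, `hSha`, `hMT`) ⟹ `KobayashiMainConjecture (M_E ⊗ ℚ) 2 1 ∧ BSDp (M_E ⊗ ℚ) 2`. The two items are hypotheses; closes nothing; BSD is
not proved by any of this. [cite: BDKim2009, Cor. 2.13 and Prop. 2.6] [cite: Kobayashi2003, Thm. 1.2 and Thm. 4.1] [cite: Kato2004Asterisque, Thm. 12.4–12.5 (3)]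
[cite: BDKim2013, Cor. 3.15] [cite: Pollack2003, Prop. 6.18] [cite: AbbesUllmo1996, Thm. A] [cite: SilvermanAEC2009, III.§1] [cite: Miller2011LMS, Def. 1.1] -/
theorem bsdp_two_baseChange_int_of_unitAnchor_of_thetaPartnerItems_negDisc
    (hmod : nonempty_modularParametrizationData) (hGZK : rank_eq_analyticRank_of_analyticRank_le_one)
    (h2 : realPeriodRat_eq_unit_mul_plusPeriod_two)
    (hK3 : Summit.BirchSwinnertonDyer.BirchSwinnertonDyer.Theses.ThetaPartnerAtTwo.SignedKatoDivisibilityUpToAtTwo)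
    (hK4 : Summit.BirchSwinnertonDyer.BirchSwinnertonDyer.Theses.ThetaPartnerAtTwo.SignedControlAtTwo)
    (hcm : ¬ (ME.baseChange ℚ).HasCM) (hL : (ME.baseChange ℚ).entireLFunction 1 ≠ 0)
    (hss : GoodSS (ME.baseChange ℚ) 2) (ha : (ME.baseChange ℚ).frobeniusTrace 2 = 0) (hΔ : ME.Δ < 0)
    (hLA : (MA.baseChange ℚ).entireLFunction 1 ≠ 0)
    (hAss : GoodSS (MA.baseChange ℚ) 2) (hAa : (MA.baseChange ℚ).frobeniusTrace 2 = 0)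
    (hTam : ¬ 2 ∣ (MA.baseChange ℚ).tamagawaProduct) (hSha : ¬ 2 ∣ (MA.baseChange ℚ).shaOrder)
    (q r : ℚ[X])
    (hroot : ∀ ξ : AlgebraicClosure ℚ, Polynomial.aeval ξ (ME.baseChange ℚ).twoTorsionPolynomial.toPoly = 0 →
      Polynomial.aeval (Polynomial.aeval ξ q) (MA.baseChange ℚ).twoTorsionPolynomial.toPoly = 0)
    (hinv : ∀ ξ : AlgebraicClosure ℚ, Polynomial.aeval ξ (ME.baseChange ℚ).twoTorsionPolynomial.toPoly = 0 →
      Polynomial.aeval (Polynomial.aeval ξ q) r = ξ)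
    (hECA : ∀ (κ : ZpExtension ℚ 2) (γ : Field.absoluteGaloisGroup ℚ),
          κ.IsCyclotomic → κ.IsTopGenerator γ → Finite ((MA.baseChange ℚ).selmerGroupPInfty 2) →
          Finite (endInvariants (conjSignedSelmerInfty (MA.baseChange ℚ) κ 1 γ - 1)) ∧
            ∃ u : ℤ_[2]ˣ, (Nat.card (endInvariants (conjSignedSelmerInfty (MA.baseChange ℚ) κ 1 γ - 1)) : ℚ_[2]) =
              ((u : ℤ_[2]) : ℚ_[2]) * ((2 : ℕ) : ℚ_[2]) ^ (padicValNat 2 (MA.baseChange ℚ).tamagawaProduct) *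
                (Nat.card ((MA.baseChange ℚ).selmerGroupPInfty 2) : ℚ_[2]) *
                  (Nat.card (EndCoinvariants (conjSignedSelmerInfty (MA.baseChange ℚ) κ 1 γ - 1)) : ℚ_[2]))
    (ℓ : ℕ)
    (hlamT : GoodSS (ME.baseChange ℚ) 2 → (ME.baseChange ℚ).frobeniusTrace 2 = 0 →
      GoodSS (MA.baseChange ℚ) 2 → (MA.baseChange ℚ).frobeniusTrace 2 = 0 →
      (∃ e : WeierstrassCurve.geomTorsion (ME.baseChange ℚ) (2 : ℤ) ≃+ WeierstrassCurve.geomTorsion (MA.baseChange ℚ) (2 : ℤ),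
        ∀ (σ : Field.absoluteGaloisGroup ℚ) (P : WeierstrassCurve.geomTorsion (ME.baseChange ℚ) (2 : ℤ)),
          e (σ • P) = σ • e P) →
      ∀ (κ : ZpExtension ℚ 2) (γ : Field.absoluteGaloisGroup ℚ), κ.IsCyclotomic → κ.IsTopGenerator γ →
      ∀ (D : SignedSelmerDualData (ME.baseChange ℚ) κ γ 1) (D' : SignedSelmerDualData (MA.baseChange ℚ) κ γ 1)
        [Module.Finite (IwasawaAlgebra 2) D.X] [Module.Finite (IwasawaAlgebra 2) D'.X],
        Module.IsTorsion (IwasawaAlgebra 2) D.X → Module.IsTorsion (IwasawaAlgebra 2) D'.X →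
        D.mu = 0 → D'.mu = 0 → lambdaInvariant 2 D.X = lambdaInvariant 2 D'.X + ℓ)
    {n : ℕ} (hn : Even n)
    (hMT : ∀ [NeZero ((ME.baseChange ℚ).conductorNorm ℤ)] (f : CuspForm (Gamma0 ((ME.baseChange ℚ).conductorNorm ℤ)) 2),
        IsNewformOf (ME.baseChange ℚ) f →
      ((mazurTateElement f 2 n).map (algebraMap ℚ (PadicAlgCl 2))).supNorm = 1 ∧
        layerLambda ((mazurTateElement f 2 n).map (algebraMap ℚ (PadicAlgCl 2))) = (2 ^ n - 1) / 3 + ℓ) :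
    KobayashiMainConjecture (ME.baseChange ℚ) 2 1 ∧ BSDp (ME.baseChange ℚ) 2 := by
  obtain ⟨e, he⟩ := ThetaPartnerXRoute.exists_equivariant_addEquiv_geomTorsion_two_of_tschirnhaus (K := ℚ)
    two_ne_zero (ME.baseChange ℚ) (MA.baseChange ℚ) q r hroot hinv
  exact kobayashiMainConjecture_and_bsdp_two_of_unitAnchor_of_thetaPartnerItems_negDisc (ME.baseChange ℚ) (MA.baseChange ℚ)
    hmod hGZK h2 hK3 hK4 hcm (analyticRank_eq_zero_of_entireLFunction_one_ne_zero _ hL) hss ha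
    (by rw [baseChange_int_Δ]; exact_mod_cast hΔ)
    (analyticRank_eq_zero_of_entireLFunction_one_ne_zero _ hLA) hAss hAa hTam hSha e he hECA ℓ hlamT hn hMT

end Door

end SSUnitAnchor
end Summit.BirchSwinnertonDyer.BirchSwinnertonDyer.Theorems

end
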